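import Literature.Computability.MetaComplexity.RefutationCNF
import HarnessLib

/-!
# Size of the refutation-statement CNF `RREF(F,s)` and of the Atserias–Müller gadget `G(F)`

Polynomial size estimates for the formulas of `RefutationCNF.lean`, as used in
[Atserias–Müller 2020, §6, proof of Thm 2]: "Note `G(F)` has size between `n^{1/q}` and `n^q` for
some constant `q > 0`" (for a 3-CNF `F` with `n` variables and `m ≤ 8n³` clauses, and
`G(F) = RREF(F, 13n²)`). We prove, for the size `CNF.size` (total number of literal occurrences):

* `RefCNF.size_rref_le` — `|RREF(F,s)| ≤ 100 · (s + n + m + 3)⁵` for `F` of width `≤ 3` with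
  variable list of length `n` and `m` clauses (each of the 24 clause families (A1)–(A24) is a
  nesting of at most five index ranges of length `≤ s + n + m + 3` around clauses of bounded
  length);
* `RefCNF.le_size_rref` — `s · (n + 2) ≤ |RREF(F,s)|` (the family (A1) alone).

The exponent is crude (the true order is `s·m² + s²n²`, from (A6) and (A17)–(A18)); only
polynomiality matters for [AM20, Thm 2]. The specialisation to the gadget (`|G(F)| ≤ 100·25⁵·n¹⁵`,
`n ≤ |G(F)|`) and the derivation of [AM20, Thm 2] from [AM20, Lemmas 10, 11] are in
`RefutationCNFProofs.lean`.

## References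

* A. Atserias, M. Müller, *Automating Resolution is NP-hard*, J. ACM 67(5) (2020), Art. 31;
  arXiv:1904.02991, §6 (proof of Thm 2: size of `G(F)`), Appendix (clause tables).
-/

namespace Literature.Computability.MetaComplexity

open _root_.Computability Complexity

namespace RefCNF

variable {ν : Type*}

/-! ### Generic size bookkeeping -/

/-- `CNF.size` is additive under concatenation. [folklore] -/
theorem size_append (φ ψ : CNF ν) : CNF.size (φ ++ ψ) = CNF.size φ + CNF.size ψ := by
  simp [CNF.size, List.map_append, List.sum_append]

/-- Renumbering the variables along `RefVar.code` preserves the size. [folklore] -/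
theorem size_toNat (φ : CNF RefVar) : CNF.size (toNat φ) = CNF.size φ := by
  simp [CNF.size, toNat, Function.comp_def]

/-- A list of at most `N` clauses each of length at most `w` has size at most `N · w`.
[folklore] -/
theorem size_map_le {α : Type*} {l : List α} {f : α → Clause ν} {N w : ℕ} (hl : l.length ≤ N)
    (h : ∀ a ∈ l, (f a).length ≤ w) : CNF.size (l.map f) ≤ N * w := by
  have h1 : ((l.map f).map List.length).sum ≤ (l.map f).length * w := by
    have := List.sum_le_card_nsmul ((l.map f).map List.length) w (by
      intro x hx
      obtain ⟨c, hc, rfl⟩ := List.mem_map.1 hx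
      obtain ⟨a, ha, rfl⟩ := List.mem_map.1 hc
      exact h a ha)
    simpa using this
  calc CNF.size (l.map f) = ((l.map f).map List.length).sum := rfl
    _ ≤ (l.map f).length * w := h1
    _ ≤ N * w := by rw [List.length_map]; exact Nat.mul_le_mul_right _ hl

/-- A concatenation of at most `N` CNFs each of size at most `b` has size at most `N · b`.
[folklore] -/
theorem size_flatMap_le {α : Type*} {l : List α} {f : α → CNF ν} {N b : ℕ} (hl : l.length ≤ N)
    (h : ∀ a ∈ l, CNF.size (f a) ≤ b) : CNF.size (l.flatMap f) ≤ N * b := by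
  induction l generalizing N with
  | nil => simp [CNF.size]
  | cons a l ih =>
    rw [List.flatMap_cons, size_append]
    cases N with
    | zero => simp at hl
    | succ N =>
      have h1 := h a (by simp)
      have h2 := ih (N := N) (by simpa using hl) (fun x hx => h x (by simp [hx]))
      calc CNF.size (f a) + CNF.size (l.flatMap f) ≤ b + N * b := Nat.add_le_add h1 h2
        _ = (N + 1) * b := by ring

/-- The index range `{0} ∪ [k]` has `k + 1` entries. [folklore] -/
@[simp] theorem length_optRange (k : ℕ) : (optRange k).length = k + 1 := by
  simp [optRange]

/-- A guard is at most one literal. [folklore] -/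
theorem length_pfx_le (rel : Bool) (u : ℕ) : (pfx rel u).length ≤ 1 := by
  cases rel <;> simp [pfx]

/-! ### Size bounds for the families (A1)–(A24)

Throughout, `B` is a common bound for the index ranges: `s + 2 ≤ B`, `n + 2 ≤ B`, `m + 2 ≤ B` as
needed. -/

variable (rel : Bool)

/-- Exact size of the guarded family (A1): `s` clauses of `n + 2` literals. [folklore] -/
theorem size_A1_true (s n : ℕ) : CNF.size (A1 true s n) = s * (n + 2) := by
  simp [A1, CNF.size, pfx, optRange, Function.comp_def]

/-- Size of (A1). [cite: AtseriasMuller2020, Appendix, clause (A1)] -/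
theorem size_A1_le {s n B : ℕ} (hs : s + 2 ≤ B) (hn : n + 2 ≤ B) :
    CNF.size (A1 rel s n) ≤ B * B := by
  unfold A1
  refine size_map_le (by simp; omega) fun u _ => ?_
  have := length_pfx_le rel u
  simp only [List.length_append, List.length_map, length_optRange]
  omega

/-- Size of (A2). [cite: AtseriasMuller2020, Appendix, clause (A2)] -/
theorem size_A2_le {s m B : ℕ} (hs : s + 2 ≤ B) (hm : m + 2 ≤ B) :
    CNF.size (A2 rel s m) ≤ B * B := by
  unfold A2
  refine size_map_le (by simp; omega) fun u _ => ?_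
  have := length_pfx_le rel u
  simp only [List.length_append, List.length_map, length_optRange]
  omega

/-- Size of (A3). [cite: AtseriasMuller2020, Appendix, clause (A3)] -/
theorem size_A3_le {s B : ℕ} (hs : s + 2 ≤ B) : CNF.size (A3 rel s) ≤ B * B := by
  unfold A3
  refine size_map_le (by simp; omega) fun u _ => ?_
  have := length_pfx_le rel u
  simp only [List.length_append, List.length_map, length_optRange]
  omega

/-- Size of (A4). [cite: AtseriasMuller2020, Appendix, clause (A4)] -/
theorem size_A4_le {s B : ℕ} (hs : s + 2 ≤ B) : CNF.size (A4 rel s) ≤ B * B := by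
  unfold A4
  refine size_map_le (by simp; omega) fun u _ => ?_
  have := length_pfx_le rel u
  simp only [List.length_append, List.length_map, length_optRange]
  omega

/-- Size of (A5). [cite: AtseriasMuller2020, Appendix, clause (A5)] -/
theorem size_A5_le {s n B : ℕ} (hs : s + 2 ≤ B) (hn : n + 2 ≤ B) :
    CNF.size (A5 rel s n) ≤ B * (B * (B * 3)) := by
  unfold A5
  refine size_flatMap_le (by simp; omega) fun u _ => ?_
  refine size_flatMap_le (by simp; omega) fun i _ => ?_
  refine size_map_le ((List.length_filter_le _ _).trans (by simp; omega)) fun i' _ => ?_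
  have := length_pfx_le rel u
  simp only [List.length_append, List.length_cons, List.length_nil]
  omega

/-- Size of (A6). [cite: AtseriasMuller2020, Appendix, clause (A6)] -/
theorem size_A6_le {s m B : ℕ} (hs : s + 2 ≤ B) (hm : m + 2 ≤ B) :
    CNF.size (A6 rel s m) ≤ B * (B * (B * 3)) := by
  unfold A6
  refine size_flatMap_le (by simp; omega) fun u _ => ?_
  refine size_flatMap_le (by simp; omega) fun j _ => ?_
  refine size_map_le ((List.length_filter_le _ _).trans (by simp; omega)) fun j' _ => ?_
  have := length_pfx_le rel u
  simp only [List.length_append, List.length_cons, List.length_nil]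
  omega

/-- Size of (A7). [cite: AtseriasMuller2020, Appendix, clause (A7)] -/
theorem size_A7_le {s B : ℕ} (hs : s + 2 ≤ B) : CNF.size (A7 rel s) ≤ B * (B * (B * 3)) := by
  unfold A7
  refine size_flatMap_le (by simp; omega) fun u _ => ?_
  refine size_flatMap_le (by simp; omega) fun v _ => ?_
  refine size_map_le ((List.length_filter_le _ _).trans (by simp; omega)) fun v' _ => ?_
  have := length_pfx_le rel u
  simp only [List.length_append, List.length_cons, List.length_nil]
  omega

/-- Size of (A8). [cite: AtseriasMuller2020, Appendix, clause (A8)] -/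
theorem size_A8_le {s B : ℕ} (hs : s + 2 ≤ B) : CNF.size (A8 rel s) ≤ B * (B * (B * 3)) := by
  unfold A8
  refine size_flatMap_le (by simp; omega) fun u _ => ?_
  refine size_flatMap_le (by simp; omega) fun v _ => ?_
  refine size_map_le ((List.length_filter_le _ _).trans (by simp; omega)) fun v' _ => ?_
  have := length_pfx_le rel u
  simp only [List.length_append, List.length_cons, List.length_nil]
  omega

/-- Size of (A9). [cite: AtseriasMuller2020, Appendix, clause (A9)] -/
theorem size_A9_le {s B : ℕ} (hs : s + 2 ≤ B) : CNF.size (A9 rel s) ≤ B * 3 := by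
  unfold A9
  refine size_map_le (by simp; omega) fun u _ => ?_
  have := length_pfx_le rel u
  simp only [List.length_append, List.length_cons, List.length_nil]
  omega

/-- Size of (A10). [cite: AtseriasMuller2020, Appendix, clause (A10)] -/
theorem size_A10_le {s B : ℕ} (hs : s + 2 ≤ B) : CNF.size (A10 rel s) ≤ B * 3 := by
  unfold A10
  refine size_map_le (by simp; omega) fun u _ => ?_
  have := length_pfx_le rel u
  simp only [List.length_append, List.length_cons, List.length_nil]
  omega

/-- Size of (A11). [cite: AtseriasMuller2020, Appendix, clause (A11)] -/
theorem size_A11_le {s B : ℕ} (hs : s + 2 ≤ B) : CNF.size (A11 rel s) ≤ B * 3 := by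
  unfold A11
  refine size_map_le (by simp; omega) fun u _ => ?_
  have := length_pfx_le rel u
  simp only [List.length_append, List.length_cons, List.length_nil]
  omega

/-- Size of (A12). [cite: AtseriasMuller2020, Appendix, clause (A12)] -/
theorem size_A12_le {s B : ℕ} (hs : s + 2 ≤ B) : CNF.size (A12 rel s) ≤ B * 3 := by
  unfold A12
  refine size_map_le (by simp; omega) fun u _ => ?_
  have := length_pfx_le rel u
  simp only [List.length_append, List.length_cons, List.length_nil]
  omega

/-- Size of (A13). [cite: AtseriasMuller2020, Appendix, clause (A13)] -/
theorem size_A13_le {s B : ℕ} (hs : s + 2 ≤ B) : CNF.size (A13 rel s) ≤ B * (B * 2) := by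
  unfold A13
  refine size_flatMap_le (by simp; omega) fun u _ => ?_
  refine size_map_le ((List.length_filter_le _ _).trans (by simp; omega)) fun v _ => ?_
  have := length_pfx_le rel u
  simp only [List.length_append, List.length_cons, List.length_nil]
  omega

/-- Size of (A14). [cite: AtseriasMuller2020, Appendix, clause (A14)] -/
theorem size_A14_le {s B : ℕ} (hs : s + 2 ≤ B) : CNF.size (A14 rel s) ≤ B * (B * 2) := by
  unfold A14
  refine size_flatMap_le (by simp; omega) fun u _ => ?_
  refine size_map_le ((List.length_filter_le _ _).trans (by simp; omega)) fun v _ => ?_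
  have := length_pfx_le rel u
  simp only [List.length_append, List.length_cons, List.length_nil]
  omega

/-- Size of (A15). [cite: AtseriasMuller2020, Appendix, clause (A15)] -/
theorem size_A15_le {s n B : ℕ} (hs : s + 2 ≤ B) (hn : n + 2 ≤ B) :
    CNF.size (A15 rel s n) ≤ B * (B * (B * 5)) := by
  unfold A15
  refine size_flatMap_le (by simp; omega) fun u _ => ?_
  refine size_flatMap_le (by simp; omega) fun v _ => ?_
  refine size_map_le (by simp; omega) fun i _ => ?_
  have := length_pfx_le rel u
  have := length_pfx_le rel v
  simp only [List.length_append, List.length_cons, List.length_nil]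
  omega

/-- Size of (A16). [cite: AtseriasMuller2020, Appendix, clause (A16)] -/
theorem size_A16_le {s n B : ℕ} (hs : s + 2 ≤ B) (hn : n + 2 ≤ B) :
    CNF.size (A16 rel s n) ≤ B * (B * (B * 5)) := by
  unfold A16
  refine size_flatMap_le (by simp; omega) fun u _ => ?_
  refine size_flatMap_le (by simp; omega) fun v _ => ?_
  refine size_map_le (by simp; omega) fun i _ => ?_
  have := length_pfx_le rel u
  have := length_pfx_le rel v
  simp only [List.length_append, List.length_cons, List.length_nil]
  omega

/-- Size of (A17). [cite: AtseriasMuller2020, Appendix, clause (A17)] -/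
theorem size_A17_le {s n B : ℕ} (hs : s + 2 ≤ B) (hn : n + 2 ≤ B) :
    CNF.size (A17 rel s n) ≤ B * (B * (B * (B * (2 * 6)))) := by
  unfold A17
  refine size_flatMap_le (by simp; omega) fun u _ => ?_
  refine size_flatMap_le (by simp; omega) fun v _ => ?_
  refine size_flatMap_le (by simp; omega) fun i _ => ?_
  refine size_flatMap_le ((List.length_filter_le _ _).trans (by simp; omega)) fun i' _ => ?_
  refine size_map_le (by simp) fun b _ => ?_
  have := length_pfx_le rel u
  have := length_pfx_le rel v
  simp only [List.length_append, List.length_cons, List.length_nil]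
  omega

/-- Size of (A18). [cite: AtseriasMuller2020, Appendix, clause (A18)] -/
theorem size_A18_le {s n B : ℕ} (hs : s + 2 ≤ B) (hn : n + 2 ≤ B) :
    CNF.size (A18 rel s n) ≤ B * (B * (B * (B * (2 * 6)))) := by
  unfold A18
  refine size_flatMap_le (by simp; omega) fun u _ => ?_
  refine size_flatMap_le (by simp; omega) fun v _ => ?_
  refine size_flatMap_le (by simp; omega) fun i _ => ?_
  refine size_flatMap_le ((List.length_filter_le _ _).trans (by simp; omega)) fun i' _ => ?_
  refine size_map_le (by simp) fun b _ => ?_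
  have := length_pfx_le rel u
  have := length_pfx_le rel v
  simp only [List.length_append, List.length_cons, List.length_nil]
  omega

/-- Size of (A19), for `F` of width at most `3`. [cite: AtseriasMuller2020, Appendix, clause (A19)]
-/
theorem size_A19_le (X : List ℕ) {F : CNF ℕ} (hw : F.IsWidthLE 3) {s B : ℕ} (hs : s + 2 ≤ B)
    (hm : F.length + 2 ≤ B) : CNF.size (A19 rel X F s) ≤ B * (B * (3 * 3)) := by
  have hget : ∀ j, (F.getD j []).length ≤ 3 := by
    intro j
    rw [List.getD_eq_getElem?_getD]
    cases h : F[j]? with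
    | none => simp
    | some c => simpa using hw c (List.mem_of_getElem? h)
  unfold A19
  refine size_flatMap_le (by simp; omega) fun u _ => ?_
  refine size_flatMap_le (by simp; omega) fun j _ => ?_
  refine size_map_le (hget j) fun l _ => ?_
  have := length_pfx_le rel u
  simp only [List.length_append, List.length_cons, List.length_nil]
  omega

/-- Size of (A20). [cite: AtseriasMuller2020, Appendix, clause (A20)] -/
theorem size_A20_le {s n B : ℕ} (hs : s + 2 ≤ B) (hn : n + 2 ≤ B) :
    CNF.size (A20 rel s n) ≤ B * (B * 3) := by
  unfold A20
  refine size_flatMap_le (by simp; omega) fun u _ => ?_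
  refine size_map_le (by simp; omega) fun i _ => ?_
  have := length_pfx_le rel u
  simp only [List.length_append, List.length_cons, List.length_nil]
  omega

/-- Size of (A21). [cite: AtseriasMuller2020, Appendix, clause (A21)] -/
theorem size_A21_le {s n B : ℕ} (hs : s + 2 ≤ B) (hn : n + 2 ≤ B) :
    CNF.size (A21 rel s n) ≤ B * (B * (2 * 2)) := by
  unfold A21
  refine size_flatMap_le ((List.length_filter_le _ _).trans (by simp; omega)) fun u _ => ?_
  refine size_flatMap_le (by simp; omega) fun i _ => ?_
  refine size_map_le (by simp) fun b _ => ?_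
  have := length_pfx_le rel u
  simp only [List.length_append, List.length_cons, List.length_nil]
  omega

/-- Size of (A22). [cite: AtseriasMuller2020, Appendix, clause (A22)] -/
theorem size_A22_le {s B : ℕ} (hs : s + 2 ≤ B) : CNF.size (A22 s) ≤ B * (B * 3) := by
  unfold A22
  refine size_flatMap_le (by simp; omega) fun u _ => ?_
  exact size_map_le (by simp; omega) fun v _ => by simp

/-- Size of (A23). [cite: AtseriasMuller2020, Appendix, clause (A23)] -/
theorem size_A23_le {s B : ℕ} (hs : s + 2 ≤ B) : CNF.size (A23 s) ≤ B * (B * 3) := by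
  unfold A23
  refine size_flatMap_le (by simp; omega) fun u _ => ?_
  exact size_map_le (by simp; omega) fun v _ => by simp

/-- Size of (A24). [cite: AtseriasMuller2020, Appendix, clause (A24)] -/
theorem size_A24_le {s B : ℕ} (hs : s + 2 ≤ B) : CNF.size (A24 s) ≤ B * 1 := by
  unfold A24
  exact size_map_le ((List.length_filter_le _ _).trans (by simp; omega)) fun u _ => by simp

/-! ### Size of `RREF(F,s)` and of the gadget -/

/-- **Polynomial size of `RREF(F,s)`**: for `F` of width `≤ 3` with variable list `X`
(`n := |X|`) and `m` clauses, `|RREF(F,s)| ≤ 100 · (s + n + m + 3)⁵`.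
[cite: AtseriasMuller2020, §6 (proof of Thm 2: "G(F) has size between n^{1/q} and n^q")] -/
theorem size_rref_le (X : List ℕ) {F : CNF ℕ} (hw : F.IsWidthLE 3) (s : ℕ) :
    CNF.size (rref X F s) ≤ 100 * (s + X.length + F.length + 3) ^ 5 := by
  obtain ⟨B, hB_def⟩ : ∃ B, B = s + X.length + F.length + 3 := ⟨_, rfl⟩
  rw [← hB_def]
  have hs : s + 2 ≤ B := by omega
  have hn : X.length + 2 ≤ B := by omega
  have hm : F.length + 2 ≤ B := by omega
  have hB1 : 1 ≤ B := by omega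
  have h1 := size_A1_le true hs hn
  have h2 := size_A2_le true hs hm
  have h3 := size_A3_le true hs
  have h4 := size_A4_le true hs
  have h5 := size_A5_le true hs hn
  have h6 := size_A6_le true hs hm
  have h7 := size_A7_le true hs
  have h8 := size_A8_le true hs
  have h9 := size_A9_le true hs
  have h10 := size_A10_le true hs
  have h11 := size_A11_le true hs
  have h12 := size_A12_le true hs
  have h13 := size_A13_le true hs
  have h14 := size_A14_le true hs
  have h15 := size_A15_le true hs hn
  have h16 := size_A16_le true hs hn
  have h17 := size_A17_le true hs hn
  have h18 := size_A18_le true hs hn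
  have h19 := size_A19_le true X hw hs hm
  have h20 := size_A20_le true hs hn
  have h21 := size_A21_le true hs hn
  have h22 := size_A22_le (s := s) hs
  have h23 := size_A23_le (s := s) hs
  have h24 := size_A24_le (s := s) hs
  have hp1 : B ≤ B ^ 5 := (pow_one B).symm.trans_le (Nat.pow_le_pow_right hB1 (by norm_num))
  have hp2 : B * B ≤ B ^ 5 := (pow_two B).symm.trans_le (Nat.pow_le_pow_right hB1 (by norm_num))
  have hp3 : B * (B * B) ≤ B ^ 5 :=
    (show B * (B * B) = B ^ 3 by ring).trans_le (Nat.pow_le_pow_right hB1 (by norm_num))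
  have hp4 : B * (B * (B * B)) ≤ B ^ 5 :=
    (show B * (B * (B * B)) = B ^ 4 by ring).trans_le (Nat.pow_le_pow_right hB1 (by norm_num))
  have e5 : B * (B * (B * 3)) = 3 * (B * (B * B)) := by ring
  have e9 : B * 3 = 3 * B := by ring
  have e13 : B * (B * 2) = 2 * (B * B) := by ring
  have e15 : B * (B * (B * 5)) = 5 * (B * (B * B)) := by ring
  have e17 : B * (B * (B * (B * (2 * 6)))) = 12 * (B * (B * (B * B))) := by ring
  have e19 : B * (B * (3 * 3)) = 9 * (B * B) := by ring
  have e20 : B * (B * 3) = 3 * (B * B) := by ring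
  have e21 : B * (B * (2 * 2)) = 4 * (B * B) := by ring
  have e24 : B * 1 = B := by ring
  rw [e5] at h5 h6 h7 h8
  rw [e9] at h9 h10 h11 h12
  rw [e13] at h13 h14
  rw [e15] at h15 h16
  rw [e17] at h17 h18
  rw [e19] at h19
  rw [e20] at h20 h22 h23
  rw [e21] at h21
  rw [e24] at h24
  simp only [rref_eq, blocks, size_append]
  generalize B * B = P2 at hp2 h1 h2 h3 h4 h13 h14 h19 h20 h21 h22 h23
  generalize B * (B * B) = P3 at hp3 h5 h6 h7 h8 h15 h16
  generalize B * (B * (B * B)) = P4 at hp4 h17 h18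
  generalize B ^ 5 = P5 at hp1 hp2 hp3 hp4 ⊢
  clear e5 e9 e13 e15 e17 e19 e20 e21 e24 hB_def hs hn hm hw
  omega

/-- **The family (A1) alone has size `s · (n + 2)`**, a lower bound for `|RREF(F,s)|`.
[cite: AtseriasMuller2020, §6 (proof of Thm 2: "G(F) has size between n^{1/q} and n^q")] -/
theorem le_size_rref (X : List ℕ) (F : CNF ℕ) (s : ℕ) :
    s * (X.length + 2) ≤ CNF.size (rref X F s) := by
  rw [← size_A1_true s X.length]
  simp only [rref_eq, blocks, size_append]
  omega

end RefCNF

end Literature.Computability.MetaComplexity
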